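/- Free-seat work of WIDTH SEAT `ym-line-cbag-p1-w2` (prover-ym-line-cbag-p1-w2-g17-0), route `EguchiKawaiDirectionLadder`
(ideator ym-idea-2, LINE 8), crux `TripleSmallBallMargin` (stmt-QuantumFields-27724): OBJECTS of the margin door —
product-form first-link fibre bounds with an arbitrary per-pair factor, the two scalar pair-factor envelopes, and the
floored-rigidity pair factor.  Definitions only (route-posited Props / explicit real functions); nothing is claimed.  The
implication «product-form fibre bound with envelopes ⇒ crux» is kernel-checked in the sibling file
`EguchiKawaiDirectionLadderMarginOfFibreBound.lean`.  ROUTE-INDEPENDENT (no Theses import).  The route bears on the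
barrier-ledger fact `EguchiKawaiBreakdown`; the Yang–Mills mass gap is NOT proved by anything here. -/
import Summits.QuantumFields.YangMills.Theorems.EguchiKawaiDirectionLadderConditionalTripleDefs
import HarnessLib

/-!
# Route `EguchiKawaiDirectionLadder`, crux `TripleSmallBallMargin`: product-form fibre bounds (objects)

Write `x_jk = |e^{iθ_j} − e^{iθ_k}|²` for the eigenvalue pairs of a diagonal first link `U 0 = diag(e^{iθ})` and
`q_t(θ) = (Haar ⊗ Haar){(W₁,W₂) : S_R(diag(e^{iθ}), W₁, W₂) ≤ t}` for the first-link fibre of the small-ball event of the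
`d = 3` Eguchi–Kawai a-priori measure.

* `ProductFibreBound g` — «`q_t(θ) ≤ exp(N²(C − η log t)) · ∏_{j<k} g(t, x_jk)` for `N ≥ N₀`, `0 < t ≤ 1`, all `θ`» (for every
  `η > 0`, some `C ≥ 0`, `N₀`).  Width seat w5's `ConditionalTripleBound` (file `…ConditionalTripleDefs`) is
  `ProductFibreBound triplePairFactor` on the nose (`conditionalTripleBound_iff_productFibreBound`).
* `PairFactorEnvelope g γ K` — on `0 < t ≤ 1`, `0 ≤ x ≤ 4`: `0 ≤ g(t,x)`, (E1) `x·g(t,x) ≤ t^{1+γ}` (with the Vandermonde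
  weight `x` of `U 0` every pair costs at least the exponent `1 + γ`), (E2) `x²·g(t,x) ≤ K·t²` (the two-link rigidity
  envelope `g ≲ (t/x)²`).  `triplePairFactor` obeys `(γ, K) = (1/2, 1)`.
* `flooredRigidityFactor γ t x = (t / max(x, t^{1−γ}))²` — entrywise rigidity of the two other links with the pair distance
  FLOORED at `t^{(1−γ)/2}`: pairs of `U 0`-eigenvalues closer than `t^{(1−γ)/2}` are charged `t^{2γ}` instead of nothing.
  Obeys the envelopes `(γ, 1)`; for `γ ≤ 1/2` it dominates `triplePairFactor`, so `ProductFibreBound (flooredRigidityFactor γ)`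
  is WEAKER than `ConditionalTripleBound` — and (sibling file) still implies the crux for every `γ ∈ (0,1]`.
-/

set_option autoImplicit false

noncomputable section

open MeasureTheory
open Literature.Barriers.QuantumFields
open Literature.LinearAlgebra.Matrix (diagonalTorusHom)

namespace Summit.QuantumFields.YangMills.Theorems.EguchiKawaiDirectionLadder

/-- **Product-form first-link fibre bound with pair factor `g`** (object posited by the margin door of
stmt-QuantumFields-27724; a predicate on pair factors, nothing asserted): for every `η > 0` there are `C ≥ 0` and `N₀` with
`(Haar ⊗ Haar){(W₁,W₂) : S_R(diag(e^{iθ}), W₁, W₂) ≤ t} ≤ exp(N²(C − η log t)) · ∏_{j<k} g(t, |e^{iθ_j} − e^{iθ_k}|²)` for all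
`N ≥ N₀`, `0 < t ≤ 1` and all eigenangles `θ : Fin N → ℝ`. -/
def ProductFibreBound (g : ℝ → ℝ → ℝ) : Prop :=
  ∀ η : ℝ, 0 < η → ∃ C : ℝ, 0 ≤ C ∧ ∃ N₀ : ℕ, ∀ N : ℕ, N₀ ≤ N → ∀ t : ℝ, 0 < t → t ≤ 1 →
    ∀ θ : Fin N → ℝ,
      ekHaar 2 N {W : EKConfig 2 N |
          ekAction (Fin.cons (diagonalTorusHom (Fin N) fun j => Circle.exp (θ j)) W : EKConfig 3 N) ≤ t} ≤
        ENNReal.ofReal (Real.exp ((N : ℝ) ^ 2 * (C - η * Real.log t)) *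
          ∏ j : Fin N, ∏ k ∈ Finset.Ioi j,
            g t (‖Complex.exp (θ j * Complex.I) - Complex.exp (θ k * Complex.I)‖ ^ 2))

/-- `ConditionalTripleBound` is the product-form fibre bound with pair factor `triplePairFactor` (definitionally). -/
theorem conditionalTripleBound_iff_productFibreBound :
    ConditionalTripleBound ↔ ProductFibreBound triplePairFactor := Iff.rfl

/-- **Pair-factor envelopes** `(γ, K)` (object of the margin door): for `0 < t ≤ 1` and `0 ≤ x ≤ 4` the factor is
non-negative, (E1) `x · g(t,x) ≤ t^{1+γ}`, and (E2) `x² · g(t,x) ≤ K · t²`. -/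
def PairFactorEnvelope (g : ℝ → ℝ → ℝ) (γ K : ℝ) : Prop :=
  ∀ t x : ℝ, 0 < t → t ≤ 1 → 0 ≤ x → x ≤ 4 →
    0 ≤ g t x ∧ x * g t x ≤ t ^ (1 + γ) ∧ x ^ 2 * g t x ≤ K * t ^ 2

/-- **The floored-rigidity pair factor** with exponent `γ`: `(t / max(x, t^{1−γ}))²` — the two-link rigidity factor
`(t/x)²` with the squared pair distance `x` floored at `t^{1−γ}` (so that pairs closer than `t^{(1−γ)/2}` are charged
`t^{2γ}`).  Object of the margin door; `ProductFibreBound (flooredRigidityFactor γ)` is the weakest fibre statement the door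
turns into the crux. -/
def flooredRigidityFactor (γ t x : ℝ) : ℝ :=
  (t / max x (t ^ (1 - γ))) ^ 2

end Summit.QuantumFields.YangMills.Theorems.EguchiKawaiDirectionLadder

end
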